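import Mathlib.Tactic

/-!
# Hub-pair graphs, I: bitmask vertex sets and breadth-first closure on `{0, …, n-1}` (p5, gen 11)

The finite model behind the pair-gadget rotation of mine-3's hub-pair theorem (§25): a relation on
the vertices `0, …, n-1` is a list of **rows** (row `i` = the bitmask of the neighbours of `i`), a
vertex set is a bitmask, and `reach n R i` is the set of vertices reachable from `i` (`n` rounds of
breadth-first search).  Everything here is kernel-computable (`Nat` bit operations only), so that the
combinatorial content of the rotation can be discharged by `decide +kernel` over all states of the
model.

* `adj R i j` — the relation (bit `j` of row `i`); `nbr n R s` — the neighbours of the set `s`;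
  `step n R s = s ||| nbr n R s`; `reach n R i = (step n R)^[n] (2 ^ i)`; `maskOf n p` — the
  bitmask of the `j < n` with `p j`;
* **`reachB_imp_rtg`** — a vertex of `reach n R i` is joined to `i` by a chain of the relation
  (inside `{0, …, n-1}`, rows bounded by `n`);
* **`reachB_of_rtg`** — conversely every chain from `i` lands in `reach n R i` (the `n`-th iterate
  is a fixed point of `step` on the bits below `n`: the counting argument `cnt`).
-/

namespace PercRepro

namespace PairModel

/-- The rows of a relation on `{0, …, n-1}`: row `i` is the bitmask of the neighbours of `i`. -/
abbrev Rows := List ℕ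

/-- Row `i` of `R` (`0` beyond the list). -/
def row (R : Rows) (i : ℕ) : ℕ := R.getD i 0

/-- The relation of the rows: `i ~ j` iff bit `j` of row `i` is set. -/
def adj (R : Rows) (i j : ℕ) : Bool := (row R i).testBit j

/-- The neighbours of the vertex set `s` (a bitmask) among the vertices `< n`. -/
def nbr : ℕ → Rows → ℕ → ℕ
  | 0, _, _ => 0
  | n + 1, R, s => (if s.testBit n then row R n else 0) ||| nbr n R s

/-- One round of breadth-first search: `s` together with its neighbours. -/
def step (n : ℕ) (R : Rows) (s : ℕ) : ℕ := s ||| nbr n R s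

/-- The vertices reachable from `i`: `n` rounds from `{i}`. -/
def reach (n : ℕ) (R : Rows) (i : ℕ) : ℕ := (step n R)^[n] (2 ^ i)

/-- `j` is reachable from `i`. -/
def reachB (n : ℕ) (R : Rows) (i j : ℕ) : Bool := (reach n R i).testBit j

/-- The bitmask of the vertices `j < n` with `p j`. -/
def maskOf : ℕ → (ℕ → Bool) → ℕ
  | 0, _ => 0
  | n + 1, p => (if p n then 2 ^ n else 0) ||| maskOf n p

/-- The chain relation of the rows inside `{0, …, n-1}`. -/
def Rel (n : ℕ) (R : Rows) (i j : ℕ) : Prop := i < n ∧ j < n ∧ adj R i j = true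

/-- The rows are bounded by `n`: no neighbour `≥ n`. -/
def Bounded (n : ℕ) (R : Rows) : Prop := ∀ i j, adj R i j = true → j < n

/-! ### Bits of the basic constructions -/

/-- Bit `j` of `maskOf n p`. -/
theorem testBit_maskOf (n : ℕ) (p : ℕ → Bool) (j : ℕ) :
    (maskOf n p).testBit j = (decide (j < n) && p j) := by
  induction n with
  | zero => simp [maskOf]
  | succ n ih =>
    simp only [maskOf, Nat.testBit_or, ih]
    rcases Nat.lt_trichotomy j n with hj | rfl | hj
    · have h2 : decide (j < n) = true := by simp [hj]
      have h3 : (2 ^ n).testBit j = false := Nat.testBit_two_pow_of_ne (ne_of_lt hj).symm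
      split_ifs <;> simp [h2, h3] <;> intro _ <;> omega
    · split_ifs with hp <;> simp [hp, Nat.testBit_two_pow_self]
    · have h2 : decide (j < n) = false := by simp; omega
      have h3 : (2 ^ n).testBit j = false := Nat.testBit_two_pow_of_ne (ne_of_lt hj)
      split_ifs <;> simp [h2, h3] <;> intro _ <;> omega

/-- Bit `j` of the neighbour set. -/
theorem testBit_nbr (n : ℕ) (R : Rows) (s j : ℕ) :
    (nbr n R s).testBit j = true ↔ ∃ i < n, s.testBit i = true ∧ adj R i j = true := by
  induction n with
  | zero => simp [nbr]
  | succ n ih =>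
    simp only [nbr, Nat.testBit_or, Bool.or_eq_true, ih]
    constructor
    · rintro (h | ⟨i, hi, hs, ha⟩)
      · by_cases hs : s.testBit n = true
        · simp only [hs, if_true] at h
          exact ⟨n, Nat.lt_succ_self n, hs, h⟩
        · simp [hs] at h
      · exact ⟨i, Nat.lt_succ_of_lt hi, hs, ha⟩
    · rintro ⟨i, hi, hs, ha⟩
      rcases Nat.lt_succ_iff_lt_or_eq.mp hi with hi | rfl
      · exact Or.inr ⟨i, hi, hs, ha⟩
      · left
        simpa [hs, adj] using ha

/-- Bit `j` of one round. -/
theorem testBit_step (n : ℕ) (R : Rows) (s j : ℕ) :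
    (step n R s).testBit j = true ↔
      s.testBit j = true ∨ ∃ i < n, s.testBit i = true ∧ adj R i j = true := by
  simp only [step, Nat.testBit_or, Bool.or_eq_true, testBit_nbr]

/-- A round only adds vertices. -/
theorem testBit_step_of_testBit {n : ℕ} {R : Rows} {s j : ℕ} (h : s.testBit j = true) :
    (step n R s).testBit j = true :=
  (testBit_step n R s j).2 (Or.inl h)

/-- The iterates only grow. -/
theorem testBit_iterate_of_testBit {n : ℕ} {R : Rows} {s j : ℕ} (h : s.testBit j = true) (k : ℕ) :
    ((step n R)^[k] s).testBit j = true := by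
  induction k with
  | zero => simpa
  | succ k ih => rw [Function.iterate_succ_apply']; exact testBit_step_of_testBit ih

/-- The start vertex is reached. -/
theorem reachB_self (n : ℕ) (R : Rows) (i : ℕ) : reachB n R i i = true :=
  testBit_iterate_of_testBit (by simp) n

/-! ### Reachability gives a chain -/

/-- A vertex of an iterate is joined to a vertex of the start set by a chain of the relation. -/
theorem testBit_iterate_imp_rtg (n : ℕ) (R : Rows) (hR : Bounded n R) (k : ℕ) (s j : ℕ)
    (h : ((step n R)^[k] s).testBit j = true) :
    ∃ i, s.testBit i = true ∧ (i = j ∨ Relation.ReflTransGen (Rel n R) i j) := by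
  induction k generalizing j with
  | zero => exact ⟨j, by simpa using h, Or.inl rfl⟩
  | succ k ih =>
    rw [Function.iterate_succ_apply', testBit_step] at h
    rcases h with h | ⟨i, hi, hs, ha⟩
    · exact ih j h
    · obtain ⟨i₀, hi₀, hchain⟩ := ih i hs
      have hij : Rel n R i j := ⟨hi, hR i j ha, ha⟩
      refine ⟨i₀, hi₀, Or.inr ?_⟩
      rcases hchain with rfl | hchain
      · exact Relation.ReflTransGen.single hij
      · exact hchain.tail hij

/-- **Reachability gives a chain**: a vertex reachable from `i` is `i` or joined to `i` by a chain of
the relation inside `{0, …, n-1}`. -/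
theorem reachB_imp_rtg {n : ℕ} {R : Rows} (hR : Bounded n R) {i j : ℕ}
    (h : reachB n R i j = true) : i = j ∨ Relation.ReflTransGen (Rel n R) i j := by
  obtain ⟨i₀, hi₀, hchain⟩ := testBit_iterate_imp_rtg n R hR n (2 ^ i) j h
  have : i = i₀ := by simpa [Nat.testBit_two_pow] using hi₀
  subst this
  exact hchain

/-! ### The `n`-th iterate is closed: a counting argument on the bits below `n` -/

/-- Two masks agree on the bits below `n`. -/
def AgreeBelow (n : ℕ) (s t : ℕ) : Prop := ∀ j < n, s.testBit j = t.testBit j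

/-- A round reads only the bits below `n`. -/
theorem step_agreeBelow {n : ℕ} {R : Rows} {s t : ℕ} (h : AgreeBelow n s t) :
    AgreeBelow n (step n R s) (step n R t) := by
  intro j hj
  apply Bool.eq_iff_iff.mpr
  simp only [testBit_step, h j hj]
  constructor
  · rintro (h' | ⟨i, hi, hs, ha⟩)
    · exact Or.inl h'
    · exact Or.inr ⟨i, hi, (h i hi) ▸ hs, ha⟩
  · rintro (h' | ⟨i, hi, hs, ha⟩)
    · exact Or.inl h'
    · exact Or.inr ⟨i, hi, (h i hi).symm ▸ hs, ha⟩

/-- The number of set bits below `n`. -/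
def cnt (n s : ℕ) : ℕ := ((Finset.range n).filter fun j => s.testBit j = true).card

/-- At most `n` bits below `n`. -/
theorem cnt_le (n s : ℕ) : cnt n s ≤ n :=
  (Finset.card_filter_le _ _).trans (by simp)

/-- Strictly more bits below `n` when the set grows and gains a bit. -/
theorem cnt_lt_of_gain {n s t : ℕ} (hst : ∀ j < n, s.testBit j = true → t.testBit j = true)
    (hgain : ∃ j < n, s.testBit j = false ∧ t.testBit j = true) : cnt n s < cnt n t := by
  obtain ⟨j, hj, hs, ht⟩ := hgain
  refine Finset.card_lt_card ⟨fun x hx => ?_, fun hsub => ?_⟩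
  · simp only [Finset.mem_filter, Finset.mem_range] at hx ⊢
    exact ⟨hx.1, hst x hx.1 hx.2⟩
  · have := hsub (Finset.mem_filter.mpr ⟨Finset.mem_range.mpr hj, ht⟩)
    rw [Finset.mem_filter, hs] at this
    simp at this

/-- A disagreement of consecutive iterates below `n` is a gained bit. -/
theorem cnt_lt_of_not_agreeBelow {n : ℕ} {R : Rows} {s : ℕ} (k : ℕ)
    (h : ¬ AgreeBelow n ((step n R)^[k] s) ((step n R)^[k + 1] s)) :
    cnt n ((step n R)^[k] s) < cnt n ((step n R)^[k + 1] s) := by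
  have hmono : ∀ j, ((step n R)^[k] s).testBit j = true →
      ((step n R)^[k + 1] s).testBit j = true := by
    intro j hs
    rw [Function.iterate_succ_apply']
    exact testBit_step_of_testBit hs
  obtain ⟨j, hj, hne⟩ : ∃ j < n,
      ((step n R)^[k] s).testBit j ≠ ((step n R)^[k + 1] s).testBit j := by
    by_contra hcon
    exact h fun j hj => by
      by_contra hne
      exact hcon ⟨j, hj, hne⟩
  refine cnt_lt_of_gain (fun j _ hj => hmono j hj) ⟨j, hj, ?_, ?_⟩
  · cases hs : ((step n R)^[k] s).testBit j
    · rfl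
    · exact absurd (hs.trans (hmono j hs).symm) hne
  · cases ht : ((step n R)^[k + 1] s).testBit j
    · cases hs : ((step n R)^[k] s).testBit j
      · exact absurd (hs.trans ht.symm) hne
      · have := hmono j hs
        rw [ht] at this
        exact absurd this (by decide)
    · rfl

/-- Agreement of consecutive iterates persists. -/
theorem agreeBelow_succ {n : ℕ} {R : Rows} {s : ℕ} {k : ℕ}
    (h : AgreeBelow n ((step n R)^[k] s) ((step n R)^[k + 1] s)) :
    AgreeBelow n ((step n R)^[k + 1] s) ((step n R)^[k + 2] s) := by
  rw [Function.iterate_succ_apply' (step n R) (k + 1), Function.iterate_succ_apply' (step n R) k]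
  rw [Function.iterate_succ_apply'] at h
  exact step_agreeBelow h

/-- Agreement at `k` gives agreement at every later index. -/
theorem agreeBelow_of_le {n : ℕ} {R : Rows} {s : ℕ} {k m : ℕ} (hkm : k ≤ m)
    (h : AgreeBelow n ((step n R)^[k] s) ((step n R)^[k + 1] s)) :
    AgreeBelow n ((step n R)^[m] s) ((step n R)^[m + 1] s) := by
  induction m, hkm using Nat.le_induction with
  | base => exact h
  | succ m _ ih => exact agreeBelow_succ ih

/-- Without agreement up to `n`, the counts grow at least linearly. -/
theorem cnt_ge_of_forall_not_agree {n : ℕ} {R : Rows} {s : ℕ}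
    (h : ∀ k ≤ n, ¬ AgreeBelow n ((step n R)^[k] s) ((step n R)^[k + 1] s)) :
    ∀ k ≤ n + 1, k ≤ cnt n ((step n R)^[k] s) := by
  intro k hk
  induction k with
  | zero => exact Nat.zero_le _
  | succ k ih =>
    have h1 := ih (Nat.le_of_succ_le hk)
    have h2 := cnt_lt_of_not_agreeBelow (n := n) (R := R) (s := s) k
      (h k (Nat.lt_succ_iff.mp hk))
    omega

/-- **The `n`-th iterate is a fixed point of `step` on the bits below `n`.** -/
theorem agreeBelow_iterate (n : ℕ) (R : Rows) (s : ℕ) :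
    AgreeBelow n ((step n R)^[n] s) ((step n R)^[n + 1] s) := by
  by_contra hne
  have hall : ∀ k ≤ n, ¬ AgreeBelow n ((step n R)^[k] s) ((step n R)^[k + 1] s) :=
    fun k hk hagree => hne (agreeBelow_of_le hk hagree)
  have := cnt_ge_of_forall_not_agree hall (n + 1) le_rfl
  have := cnt_le n ((step n R)^[n + 1] s)
  omega

/-- **Closure**: a neighbour (below `n`) of a reached vertex is reached. -/
theorem reachB_of_reachB_adj {n : ℕ} {R : Rows} {i j k : ℕ} (hj : j < n) (hk : k < n)
    (hij : reachB n R i j = true) (hjk : adj R j k = true) : reachB n R i k = true := by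
  have h1 : ((step n R)^[n + 1] (2 ^ i)).testBit k = true := by
    rw [Function.iterate_succ_apply', testBit_step]
    exact Or.inr ⟨j, hj, hij, hjk⟩
  unfold reachB reach
  rw [agreeBelow_iterate n R (2 ^ i) k hk]
  exact h1

/-- **A chain gives reachability**: every vertex joined to `i` by a chain of the relation inside
`{0, …, n-1}` lies in `reach n R i`. -/
theorem reachB_of_rtg {n : ℕ} {R : Rows} {i j : ℕ} (h : Relation.ReflTransGen (Rel n R) i j) :
    reachB n R i j = true := by
  induction h with
  | refl => exact reachB_self n R i
  | tail _ hjk ih => exact reachB_of_reachB_adj hjk.1 hjk.2.1 ih hjk.2.2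

/-- Reachability below `n` is the chain relation (rows bounded). -/
theorem reachB_iff {n : ℕ} {R : Rows} (hR : Bounded n R) {i j : ℕ} :
    reachB n R i j = true ↔ i = j ∨ Relation.ReflTransGen (Rel n R) i j :=
  ⟨reachB_imp_rtg hR, fun h => by
    rcases h with rfl | h
    · exact reachB_self n R i
    · exact reachB_of_rtg h⟩

/-- The rows of `maskOf`'s are bounded. -/
theorem bounded_of_maskOf (n : ℕ) (f : ℕ → ℕ → Bool) :
    Bounded n ((List.range n).map fun i => maskOf n (f i)) := by
  intro i j h
  simp only [adj, row] at h
  by_cases hi : i < n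
  · rw [List.getD_eq_getElem?_getD, List.getElem?_map, List.getElem?_range hi] at h
    simp only [Option.map_some, Option.getD_some, testBit_maskOf, Bool.and_eq_true,
      decide_eq_true_eq] at h
    exact h.1
  · rw [List.getD_eq_getElem?_getD, List.getElem?_map,
      List.getElem?_eq_none (by simpa using hi)] at h
    simp at h

/-- Row `i < n` of a mapped range. -/
theorem row_map_range {n : ℕ} {f : ℕ → ℕ} {i : ℕ} (hi : i < n) :
    row ((List.range n).map f) i = f i := by
  simp [row, List.getD_eq_getElem?_getD, List.getElem?_map, List.getElem?_range hi]

/-- Row `i ≥ n` of a mapped range is empty. -/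
theorem row_map_range_of_le {n : ℕ} {f : ℕ → ℕ} {i : ℕ} (hi : n ≤ i) :
    row ((List.range n).map f) i = 0 := by
  have h0 : (List.range n)[i]? = none := List.getElem?_eq_none (by simpa using hi)
  simp [row, List.getD_eq_getElem?_getD, List.getElem?_map, h0]

end PairModel

end PercRepro
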